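import Summits.ValiantsHypothesis.ValiantsHypothesis.Theses.FeketeSOS
import Summits.ValiantsHypothesis.ValiantsHypothesis.Theorems.SOSMagnification.Negative.FeketeTwoSquaresStructure

/-!
# Route `FeketeSOS`, support item `ThinSquaresCovering` (stmt-ValiantsHypothesis-4000)

The covering lemma of the card (reduction to fat squares): if the Fekete polynomial
`F_p = ∑_{m<p} (m|p) X^m ∈ ℂ[X]` is a weighted sum of squares `F_p = ∑_{i<s} cᵢ gᵢ²` and every
`gᵢ` has at most `M` monomials, then

  `2 (p − 1) ≤ (M + 1) · ∑ᵢ |supp gᵢ|`.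

Proof (the counting of Dutta–Saxena–Thierauf, comput. complexity 33 (2024), eq. (3)
[DuttaSaxenaThierauf2024], with the symmetric sumset bound):
* every `m ∈ [1, p−1]` is in `supp F_p` (`(m|p) = ±1`), hence in `supp (cᵢ gᵢ²) ⊆ supp (gᵢ²)` for
  some `i`, hence in the sumset `Sᵢ + Sᵢ`, `Sᵢ = supp gᵢ` (`mem_add_self_of_coeff_sq_ne_zero`);
* `2 |S + S| ≤ |S| (|S| + 1)` for every finite set `S` in a commutative additive monoid
  (`two_mul_card_add_self_le`, induction on `S`);
* so `2 (p − 1) ≤ ∑ᵢ 2 |Sᵢ + Sᵢ| ≤ ∑ᵢ |Sᵢ| (|Sᵢ| + 1) ≤ (M + 1) ∑ᵢ |Sᵢ|`.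

No definition is introduced; `coeff_fekete` is reused from
`Theorems/SOSMagnification/Negative/FeketeTwoSquaresStructure.lean`.
-/

namespace Summit.ValiantsHypothesis.ValiantsHypothesis.Theorems

set_option linter.dupNamespace false

open Polynomial
open scoped BigOperators Pointwise

namespace FeketeSOSThinSquaresCovering

/-- **Symmetric sumset bound.** For a finite set `S` in a commutative additive monoid,
`2 · |S + S| ≤ |S| · (|S| + 1)` (the sums `a + b` and `b + a` coincide). [folklore] -/
theorem two_mul_card_add_self_le {α : Type*} [AddCommMonoid α] [DecidableEq α] (S : Finset α) :
    2 * (S + S).card ≤ S.card * (S.card + 1) := by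
  induction S using Finset.induction_on with
  | empty => simp
  | insert a s ha ih =>
    have hsub : insert a s + insert a s ⊆ insert (a + a) (s.image (a + ·) ∪ (s + s)) := by
      intro x hx
      obtain ⟨y, hy, z, hz, rfl⟩ := Finset.mem_add.mp hx
      rw [Finset.mem_insert] at hy hz
      rw [Finset.mem_insert, Finset.mem_union, Finset.mem_image]
      rcases hy with rfl | hy
      · rcases hz with rfl | hz
        · exact Or.inl rfl
        · exact Or.inr (Or.inl ⟨z, hz, rfl⟩)
      · rcases hz with rfl | hz
        · exact Or.inr (Or.inl ⟨y, hy, add_comm _ _⟩)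
        · exact Or.inr (Or.inr (Finset.add_mem_add hy hz))
    have h1 := Finset.card_le_card hsub
    have h2 := Finset.card_insert_le (a + a) (s.image (a + ·) ∪ (s + s))
    have h3 := Finset.card_union_le (s.image (a + ·)) (s + s)
    have h4 : (s.image (a + ·)).card ≤ s.card := Finset.card_image_le
    rw [Finset.card_insert_of_notMem ha]
    nlinarith [ih, h1, h2, h3, h4]

/-- If the coefficient of `X^m` in `g²` is nonzero then `m ∈ supp g + supp g`. [folklore] -/
theorem mem_add_self_of_coeff_sq_ne_zero {R : Type*} [CommSemiring R] (g : R[X]) (m : ℕ)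
    (h : (g ^ 2).coeff m ≠ 0) : m ∈ g.support + g.support := by
  rw [pow_two, coeff_mul] at h
  obtain ⟨x, hx, hx'⟩ := Finset.exists_ne_zero_of_sum_ne_zero h
  rw [Finset.HasAntidiagonal.mem_antidiagonal] at hx
  rw [← hx]
  exact Finset.add_mem_add (mem_support_iff.mpr (left_ne_zero_of_mul hx'))
    (mem_support_iff.mpr (right_ne_zero_of_mul hx'))

/-- The Legendre symbol `(m|p)` is nonzero for `0 < m < p`. [folklore] -/
theorem legendreSym_natCast_ne_zero (p : ℕ) [Fact p.Prime] (m : ℕ) (hm0 : 0 < m) (hmp : m < p) :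
    legendreSym p m ≠ 0 := by
  rw [Ne, legendreSym.eq_zero_iff, Int.cast_natCast, ZMod.natCast_eq_zero_iff]
  exact fun h => absurd (Nat.le_of_dvd hm0 h) (not_le.mpr hmp)

/-- **Covering by sumsets of the supports.** In a weighted-SOS representation
`∑ᵢ cᵢ gᵢ² = F_p`, every `m` with `0 < m < p` lies in `supp gᵢ + supp gᵢ` for some `i`.
[cite: DuttaSaxenaThierauf2024, eq. (3)] -/
theorem exists_mem_add_self_of_feketeRep (p : ℕ) [Fact p.Prime] {s : ℕ} (c : Fin s → ℂ)
    (g : Fin s → ℂ[X])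
    (hrep : (∑ i, C (c i) * g i ^ 2) =
      ∑ m ∈ Finset.range p, C ((legendreSym p m : ℤ) : ℂ) * X ^ m)
    (m : ℕ) (hm0 : 0 < m) (hmp : m < p) : ∃ i, m ∈ (g i).support + (g i).support := by
  have hcoeff : (∑ i, C (c i) * g i ^ 2).coeff m ≠ 0 := by
    rw [hrep, SOSMagnification.Negative.coeff_fekete, if_pos hmp]
    exact_mod_cast legendreSym_natCast_ne_zero p m hm0 hmp
  rw [finsetSum_coeff] at hcoeff
  obtain ⟨i, -, hi⟩ := Finset.exists_ne_zero_of_sum_ne_zero hcoeff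
  rw [coeff_C_mul] at hi
  exact ⟨i, mem_add_self_of_coeff_sq_ne_zero (g i) m (right_ne_zero_of_mul hi)⟩

/-- **The counting bound in `ℕ`.** In a weighted-SOS representation `∑ᵢ cᵢ gᵢ² = F_p` with all
`|supp gᵢ| ≤ M`, `2 (p − 1) ≤ (M + 1) ∑ᵢ |supp gᵢ|`. [cite: DuttaSaxenaThierauf2024, eq. (3)] -/
theorem two_mul_pred_le_of_feketeRep (p : ℕ) [Fact p.Prime] {s : ℕ} (M : ℕ) (c : Fin s → ℂ)
    (g : Fin s → ℂ[X]) (hM : ∀ i, (g i).support.card ≤ M)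
    (hrep : (∑ i, C (c i) * g i ^ 2) =
      ∑ m ∈ Finset.range p, C ((legendreSym p m : ℤ) : ℂ) * X ^ m) :
    2 * (p - 1) ≤ (M + 1) * ∑ i, (g i).support.card := by
  have hsub : (Finset.range p).erase 0 ⊆
      Finset.univ.biUnion (fun i => (g i).support + (g i).support) := by
    intro m hm
    rw [Finset.mem_erase, Finset.mem_range] at hm
    obtain ⟨i, hi⟩ := exists_mem_add_self_of_feketeRep p c g hrep m (Nat.pos_of_ne_zero hm.1) hm.2
    exact Finset.mem_biUnion.mpr ⟨i, Finset.mem_univ _, hi⟩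
  have hcard : p - 1 ≤ ∑ i, ((g i).support + (g i).support).card := by
    have h := Finset.card_le_card hsub
    rw [Finset.card_erase_of_mem (Finset.mem_range.mpr (Fact.out : p.Prime).pos),
      Finset.card_range] at h
    exact h.trans Finset.card_biUnion_le
  calc 2 * (p - 1) ≤ 2 * ∑ i, ((g i).support + (g i).support).card := Nat.mul_le_mul_left 2 hcard
    _ = ∑ i, 2 * ((g i).support + (g i).support).card := Finset.mul_sum _ _ _
    _ ≤ ∑ i, (g i).support.card * ((g i).support.card + 1) :=
        Finset.sum_le_sum fun i _ => two_mul_card_add_self_le _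
    _ ≤ ∑ i, (M + 1) * (g i).support.card :=
        Finset.sum_le_sum fun i _ => by
          rw [mul_comm]; exact Nat.mul_le_mul_right _ (Nat.succ_le_succ (hM i))
    _ = (M + 1) * ∑ i, (g i).support.card := (Finset.mul_sum _ _ _).symm

end FeketeSOSThinSquaresCovering

open FeketeSOSThinSquaresCovering in
/-- **Item `ThinSquaresCovering` (stmt-ValiantsHypothesis-4000).** If every `gᵢ` in a weighted-SOS
representation `∑ᵢ cᵢ gᵢ² = F_p` of the Fekete polynomial has `|supp gᵢ| ≤ M`, then
`2 (p − 1) ≤ (M + 1) · ∑ᵢ |supp gᵢ|` (over `ℝ`). [cite: DuttaSaxenaThierauf2024, eq. (3)] -/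
theorem thinSquaresCovering_proof :
    Summit.ValiantsHypothesis.ValiantsHypothesis.Theses.FeketeSOS.ThinSquaresCovering := by
  unfold Summit.ValiantsHypothesis.ValiantsHypothesis.Theses.FeketeSOS.ThinSquaresCovering
  intro p hp s M c g hM hrep
  have hnat := two_mul_pred_le_of_feketeRep p M c g hM hrep
  have hp1 : 1 ≤ p := hp.out.one_lt.le
  have hreal := (Nat.cast_le (α := ℝ)).mpr hnat
  rw [Nat.cast_mul, Nat.cast_sub hp1] at hreal
  push_cast at hreal
  exact hreal

end Summit.ValiantsHypothesis.ValiantsHypothesis.Theorems
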